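import Literature.Analysis.FluidPDE.NSLocalAnalyticityRadiusScaling
import Literature.Analysis.FluidPDE.NSLocalAnalyticityRadiusUnitScaleTools
import Literature.Analysis.FluidPDE.NSLocalAnalyticityRadiusCover
import HarnessLib

/-!
# BGK local analyticity radius: reduction to `q`-free small data at unit scale

Analysis/FluidPDE proofs file (theorems only), companion of `NSLocalAnalyticityRadius.lean`
(named fact `bradshawGrujicKukavica2015_local_analyticity_radius`, Bradshaw–Grujić–Kukavica,
J. Differential Equations 259 (2015), Thm. 2.3; LMS Lecture Notes 430 (2016), Thm. 2.3.1).

The last of the reductions of the fact (after `…Reduction.lean`: solutions smooth across the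
initial time; `…Scaling.lean`: unit time and origin; `…Cover.lean`: balls of unit size). The
theorem `bradshawGrujicKukavica2015_local_analyticity_radius_of_small` states: **the fact follows
from the following `q`-free, small-data, unit-scale core**, for ANY choice of an aspect
parameter `R ≥ 2` — there are `ε₀ > 0` and `C₀ > 0` such that for every centre `x₁`, every
`δ > 0` and every smooth solution `(u, p)` of `∂ₜu + (u·∇)u = Δu - ∇p`, `div u = 0` on
`(-δ, R²) × B(x₁, R)` with `sup_t ‖u(t)‖_{L³(B(x₁,R))} ≤ ε₀`, `sup_t ‖p(t)‖_{L^{3/2}(B(x₁,R))} ≤ ε₀`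
and `∫₀^{R²} ‖∇u(t)‖²_{L²(B(x₁,R))} dt ≤ ε₀²`, the slice `u(1)` agrees on `B(x₁, 1)` with a map
holomorphic on `localComplexTube x₁ 1 (1/(4C₀))`. (The freedom in `R` — the size of the
controlled cylinder around the unit ball at unit elapsed time — is the freedom in the window
constant `C` of the fact; an engine whose window is `t ≤ r_*²/C_e` needs `R² ≳ C_e`.)

Proof: take `C = R² + 9 + W/ε₀ + (1 + R²)W²/ε₀²`, `W = max(1, vol B(0,R))`, in
`bradshawGrujicKukavica2015_local_analyticity_radius_of_core_unit`. If the window of the data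
`(r_*, T₀, q, r, A, B, D)` contains `1`, then `T₀ > C ≥ R²`, `r_*² > C` (so `r_* > R`) and
`A, B, D < 1/C` (`bgk_small_of_window`); for `x₁ ∈ B(0, r_*)` the ball `B(x₁, R)` lies in
`B(0, 4r_*)`, Hölder's inequality on it bounds the `L³`, `L^{3/2}` and `L²` quantities by
`W · (1/C)`-multiples of the `L^q`, `L^{q/2}`, `L^r_t L^q_x` ones uniformly in `q > 3`
(`eLpNorm_le_eLpNorm_mul_max_one_measure`, `lintegral_sq_le_of_lintegral_rpow_le`), whence the
smallness hypotheses of the core; the extensions above the unit balls `B(x₁, 1)` glue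
(`exists_differentiableOn_localComplexTube_of_forall_unit_ball`).

What remains for the discharge of the fact is this core: a local `ε`-regularity-type spatial
analyticity statement at unit scale (BGK 2015 §3–§4 after rescaling; the tree's
`lemarieRieusset_epsilon_regularity_holds` supplies the `L^∞` bound of `u` on interior
cylinders).

## References

* Z. Bradshaw, Z. Grujić, I. Kukavica, J. Differential Equations 259 (2015), Thm. 2.3 and §4.
  [BradshawGrujicKukavica2015]
* L. Caffarelli, R. Kohn, L. Nirenberg, Comm. Pure Appl. Math. 35 (1982), (1.5)–(1.6).
  [CaffarelliKohnNirenberg1982]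
-/

noncomputable section

open MeasureTheory Set Function Filter TopologicalSpace Metric
open _root_.Topology
open scoped ENNReal ContDiff Laplacian InnerProductSpace RealInnerProductSpace
open Literature.Analysis.FunctionSpaces.EuclideanSpace (complexify complexify_apply norm_complexify
  complexify_injective continuous_complexify)

namespace Literature.Analysis.FluidPDE

/-! ### Measurability of slices of jointly smooth fields -/

/-- A slice `u t` of a field jointly smooth on `S × V` is a.e.-strongly measurable on `V`
(it is continuous there). [folklore] -/
theorem aestronglyMeasurable_slice_of_contDiffOn {F : Type*} [NormedAddCommGroup F]
    [NormedSpace ℝ F] {S : Set ℝ} {V : Set (EuclideanSpace ℝ (Fin 3))}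
    {u : ℝ → EuclideanSpace ℝ (Fin 3) → F} (hu : ContDiffOn ℝ ∞ (uncurry u) (S ×ˢ V))
    (hV : MeasurableSet V) {t : ℝ} (ht : t ∈ S) :
    AEStronglyMeasurable (u t) (volume.restrict V) := by
  have h1 : ContinuousOn (fun x : EuclideanSpace ℝ (Fin 3) => (t, x)) V := by fun_prop
  have hc : ContinuousOn (u t) V := hu.continuousOn.comp h1 fun x hx => ⟨ht, hx⟩
  exact hc.aestronglyMeasurable hV

/-- The gradient size `|∇u(t)|` of a slice of a field jointly smooth on `S × V`, `V` open, is
a.e.-strongly measurable on `V` (it is continuous there). [folklore] -/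
theorem aestronglyMeasurable_sqrt_frobeniusNormSq_fderiv_slice {S : Set ℝ}
    {V : Set (EuclideanSpace ℝ (Fin 3))} (hV : IsOpen V)
    {u : ℝ → EuclideanSpace ℝ (Fin 3) → EuclideanSpace ℝ (Fin 3)}
    (hu : ContDiffOn ℝ ∞ (uncurry u) (S ×ˢ V)) {t : ℝ} (ht : t ∈ S) :
    AEStronglyMeasurable (fun x => Real.sqrt (frobeniusNormSq (fderiv ℝ (u t) x)))
      (volume.restrict V) := by
  have hslice : ContDiffOn ℝ ∞ (u t) V :=
    hu.comp (contDiffOn_const.prodMk contDiffOn_id) fun x hx => ⟨ht, hx⟩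
  have hc : ContinuousOn (fun x => Real.sqrt (frobeniusNormSq (fderiv ℝ (u t) x))) V :=
    (Real.continuous_sqrt.comp continuous_frobeniusNormSq_clm).comp_continuousOn
      (hslice.continuousOn_fderiv_of_isOpen hV (by simp))
  exact hc.aestronglyMeasurable hV.measurableSet

/-! ### The fact from the `q`-free small-data unit-scale core -/

/-- **The fact follows from its `q`-free, small-data, unit-scale core** (see the module
docstring for the statement of the core and the proof).
[cite: BradshawGrujicKukavica2015, Thm. 2.3 and §4] -/
theorem bradshawGrujicKukavica2015_local_analyticity_radius_of_small {R ε₀ C₀ : ℝ}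
    (hR : 2 ≤ R) (hε₀ : 0 < ε₀) (hC₀ : 0 < C₀)
    (hsmall : ∀ (x₁ : EuclideanSpace ℝ (Fin 3)) ⦃δ : ℝ⦄, 0 < δ →
      ∀ ⦃u : ℝ → EuclideanSpace ℝ (Fin 3) → EuclideanSpace ℝ (Fin 3)⦄
        ⦃p : ℝ → EuclideanSpace ℝ (Fin 3) → ℝ⦄,
        ContDiffOn ℝ ∞ (uncurry u) (Ioo (-δ) (R ^ 2) ×ˢ ball x₁ R) →
        ContDiffOn ℝ ∞ (uncurry p) (Ioo (-δ) (R ^ 2) ×ˢ ball x₁ R) →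
        (∀ t ∈ Ioo (-δ) (R ^ 2), ∀ x ∈ ball x₁ R,
          deriv (fun s => u s x) t + convect (u t) (u t) x = Δ (u t) x - gradient (p t) x) →
        (∀ t ∈ Ioo (-δ) (R ^ 2), ∀ x ∈ ball x₁ R, VectorCalculus.divergence (u t) x = 0) →
        (∀ t ∈ Ioo (-δ) (R ^ 2),
          eLpNorm (u t) 3 (volume.restrict (ball x₁ R)) ≤ ENNReal.ofReal ε₀) →
        (∀ t ∈ Ioo (-δ) (R ^ 2),
          eLpNorm (p t) (ENNReal.ofReal (3 / 2)) (volume.restrict (ball x₁ R)) ≤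
            ENNReal.ofReal ε₀) →
        (∫⁻ t in Ioo 0 (R ^ 2),
          eLpNorm (fun x => Real.sqrt (frobeniusNormSq (fderiv ℝ (u t) x))) 2
            (volume.restrict (ball x₁ R)) ^ (2 : ℝ) ≤ ENNReal.ofReal (ε₀ ^ 2)) →
        ∃ U : EuclideanSpace ℂ (Fin 3) → EuclideanSpace ℂ (Fin 3),
          DifferentiableOn ℂ U (localComplexTube x₁ 1 (1 / (4 * C₀))) ∧
          ∀ x ∈ ball x₁ 1, U (complexify x) = complexify (u 1 x)) :
    bradshawGrujicKukavica2015_local_analyticity_radius := by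
  have hR0 : 0 < R := by linarith
  have hR2 : 0 < R ^ 2 := by positivity
  -- the `q`-free Hölder constant on balls of radius `R`
  set W : ℝ≥0∞ := max 1 (volume (ball (0 : EuclideanSpace ℝ (Fin 3)) R)) with hW
  have hWtop : W ≠ ⊤ := (max_lt ENNReal.one_lt_top measure_ball_lt_top).ne
  set Wr : ℝ := W.toReal with hWr
  have hWofReal : W = ENNReal.ofReal Wr := (ENNReal.ofReal_toReal hWtop).symm
  have hWr1 : 1 ≤ Wr := by
    have := ENNReal.toReal_mono hWtop (le_max_left _ _ : (1 : ℝ≥0∞) ≤ W)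
    rwa [ENNReal.toReal_one] at this
  have hWr0 : 0 < Wr := one_pos.trans_le hWr1
  -- the constant `C`
  set C : ℝ := R ^ 2 + 9 + Wr / ε₀ + (1 + R ^ 2) * Wr ^ 2 / ε₀ ^ 2 with hCdef
  have ht1 : 0 ≤ Wr / ε₀ := by positivity
  have ht2 : 0 ≤ (1 + R ^ 2) * Wr ^ 2 / ε₀ ^ 2 := by positivity
  have hCR : R ^ 2 + 9 ≤ C := by rw [hCdef]; linarith
  have hC1 : 1 ≤ C := by linarith
  have hCpos : 0 < C := by linarith
  have hCW : Wr / ε₀ ≤ C := by rw [hCdef]; linarith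
  have hCW2 : (1 + R ^ 2) * Wr ^ 2 / ε₀ ^ 2 ≤ C := by rw [hCdef]; linarith
  have hWC : Wr / C ≤ ε₀ := by
    rw [div_le_iff₀ hCpos]
    rw [div_le_iff₀ hε₀] at hCW
    linarith [mul_comm ε₀ C]
  have hWC2 : Wr ^ 2 * ((1 + R ^ 2) / C) ≤ ε₀ ^ 2 := by
    rw [mul_div_assoc', div_le_iff₀ hCpos]
    rw [div_le_iff₀ (by positivity : (0 : ℝ) < ε₀ ^ 2)] at hCW2
    linarith [mul_comm (ε₀ ^ 2) C]
  refine bradshawGrujicKukavica2015_local_analyticity_radius_of_core_unit hC₀ hC1 ?_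
  intro rc T₀ q r δ hrc hT₀ hq hr hδ u p hu hp hns hdiv A B D hA hB hD huA hpB hgrad hwin
  obtain ⟨hCT, hCrc, hAC, hBC, hDC⟩ := bgk_small_of_window hC1 hT₀ hq hr hA hB hD hwin
  have hRrc : R ≤ rc := by
    by_contra hcon
    have : rc ^ 2 ≤ R ^ 2 := pow_le_pow_left₀ hrc.le (not_le.1 hcon).le 2
    linarith
  have hTR : R ^ 2 ≤ T₀ := by linarith
  have hq0 : 0 < q := by linarith
  have hr2 : 2 < r := by
    have h1 : (2 : ℝ) < 2 * q / (q - 3) := by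
      rw [lt_div_iff₀ (by linarith)]; nlinarith
    exact h1.trans hr
  have h1C : 1 / C ≤ 1 := by rw [div_le_one hCpos]; exact hC1
  -- cover `B(0, r_*)` by unit balls
  refine exists_differentiableOn_localComplexTube_of_forall_unit_ball fun x₁ hx₁ => ?_
  have hsub : ball x₁ R ⊆ ball (0 : EuclideanSpace ℝ (Fin 3)) (4 * rc) :=
    ball_subset_ball_four_mul hRrc hx₁
  have hIoo : Ioo (-δ) (R ^ 2) ⊆ Ioo (-δ) T₀ := Ioo_subset_Ioo le_rfl hTR
  have hcyl : Ioo (-δ) (R ^ 2) ×ˢ ball x₁ R ⊆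
      Ioo (-δ) T₀ ×ˢ ball (0 : EuclideanSpace ℝ (Fin 3)) (4 * rc) :=
    prod_mono hIoo hsub
  have hμ : volume.restrict (ball x₁ R) ≤
      volume.restrict (ball (0 : EuclideanSpace ℝ (Fin 3)) (4 * rc)) :=
    Measure.restrict_mono hsub le_rfl
  have hWx : max 1 ((volume.restrict (ball x₁ R)) univ) = W := by
    rw [Measure.restrict_apply_univ, (volume_ball_eq_volume_ball_zero x₁ R).1]
  have h3q : (3 : ℝ≥0∞) ≤ ENNReal.ofReal q := by
    rw [show (3 : ℝ≥0∞) = ENNReal.ofReal 3 by norm_num]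
    exact ENNReal.ofReal_le_ofReal hq.le
  have h32q : ENNReal.ofReal (3 / 2) ≤ ENNReal.ofReal (q / 2) :=
    ENNReal.ofReal_le_ofReal (by linarith)
  have h132 : (1 : ℝ≥0∞) ≤ ENNReal.ofReal (3 / 2) := by
    rw [← ENNReal.ofReal_one]; exact ENNReal.ofReal_le_ofReal (by norm_num)
  have h2q : (2 : ℝ≥0∞) ≤ ENNReal.ofReal q := by
    rw [show (2 : ℝ≥0∞) = ENNReal.ofReal 2 by norm_num]
    exact ENNReal.ofReal_le_ofReal (by linarith)
  refine hsmall x₁ hδ (hu.mono hcyl) (hp.mono hcyl)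
    (fun t ht x hx => hns t (hIoo ht) x (hsub hx)) (fun t ht x hx => hdiv t (hIoo ht) x (hsub hx))
    (fun t ht => ?_) (fun t ht => ?_) ?_
  · -- `L³`
    have hmeas : AEStronglyMeasurable (u t) (volume.restrict (ball x₁ R)) :=
      aestronglyMeasurable_slice_of_contDiffOn (hu.mono hcyl) measurableSet_ball ht
    calc eLpNorm (u t) 3 (volume.restrict (ball x₁ R))
        ≤ eLpNorm (u t) (ENNReal.ofReal q) (volume.restrict (ball x₁ R)) *
            max 1 ((volume.restrict (ball x₁ R)) univ) :=
          eLpNorm_le_eLpNorm_mul_max_one_measure (by norm_num) h3q hmeas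
      _ ≤ eLpNorm (u t) (ENNReal.ofReal q)
            (volume.restrict (ball (0 : EuclideanSpace ℝ (Fin 3)) (4 * rc))) * W := by
          rw [hWx]
          exact mul_le_mul' (eLpNorm_mono_measure _ hμ) le_rfl
      _ ≤ ENNReal.ofReal (1 / C) * W :=
          mul_le_mul' ((huA t (hIoo ht)).trans (ENNReal.ofReal_le_ofReal hAC.le)) le_rfl
      _ = ENNReal.ofReal (Wr / C) := by
          rw [hWofReal, ← ENNReal.ofReal_mul (by positivity)]
          congr 1
          ring
      _ ≤ ENNReal.ofReal ε₀ := ENNReal.ofReal_le_ofReal hWC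
  · -- `L^{3/2}` (pressure)
    have hmeas : AEStronglyMeasurable (p t) (volume.restrict (ball x₁ R)) :=
      aestronglyMeasurable_slice_of_contDiffOn (hp.mono hcyl) measurableSet_ball ht
    have hB2 : B ^ 2 ≤ 1 / C := by
      have hB1 : B ≤ 1 := hBC.le.trans h1C
      nlinarith
    calc eLpNorm (p t) (ENNReal.ofReal (3 / 2)) (volume.restrict (ball x₁ R))
        ≤ eLpNorm (p t) (ENNReal.ofReal (q / 2)) (volume.restrict (ball x₁ R)) *
            max 1 ((volume.restrict (ball x₁ R)) univ) :=
          eLpNorm_le_eLpNorm_mul_max_one_measure h132 h32q hmeas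
      _ ≤ eLpNorm (p t) (ENNReal.ofReal (q / 2))
            (volume.restrict (ball (0 : EuclideanSpace ℝ (Fin 3)) (4 * rc))) * W := by
          rw [hWx]
          exact mul_le_mul' (eLpNorm_mono_measure _ hμ) le_rfl
      _ ≤ ENNReal.ofReal (1 / C) * W :=
          mul_le_mul' ((hpB t (hIoo ht)).trans (ENNReal.ofReal_le_ofReal hB2)) le_rfl
      _ = ENNReal.ofReal (Wr / C) := by
          rw [hWofReal, ← ENNReal.ofReal_mul (by positivity)]
          congr 1
          ring
      _ ≤ ENNReal.ofReal ε₀ := ENNReal.ofReal_le_ofReal hWC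
  · -- `L²_t L²_x` (gradient)
    set G : ℝ → ℝ≥0∞ := fun t =>
      eLpNorm (fun x => Real.sqrt (frobeniusNormSq (fderiv ℝ (u t) x))) (ENNReal.ofReal q)
        (volume.restrict (ball (0 : EuclideanSpace ℝ (Fin 3)) (4 * rc))) with hG
    have hG8 : ∀ t ∈ Ioo (0 : ℝ) (R ^ 2),
        eLpNorm (fun x => Real.sqrt (frobeniusNormSq (fderiv ℝ (u t) x))) 2
          (volume.restrict (ball x₁ R)) ^ (2 : ℝ) ≤ W ^ (2 : ℝ) * G t ^ (2 : ℝ) := by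
      intro t ht
      have ht' : t ∈ Ioo (-δ) T₀ := ⟨by linarith [ht.1], by linarith [ht.2]⟩
      have hmeas : AEStronglyMeasurable
          (fun x => Real.sqrt (frobeniusNormSq (fderiv ℝ (u t) x)))
          (volume.restrict (ball x₁ R)) :=
        aestronglyMeasurable_sqrt_frobeniusNormSq_fderiv_slice isOpen_ball
          (hu.mono (prod_mono Subset.rfl hsub)) ht'
      have h1 : eLpNorm (fun x => Real.sqrt (frobeniusNormSq (fderiv ℝ (u t) x))) 2
          (volume.restrict (ball x₁ R)) ≤ G t * W := by
        calc eLpNorm (fun x => Real.sqrt (frobeniusNormSq (fderiv ℝ (u t) x))) 2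
              (volume.restrict (ball x₁ R))
            ≤ eLpNorm (fun x => Real.sqrt (frobeniusNormSq (fderiv ℝ (u t) x)))
                (ENNReal.ofReal q) (volume.restrict (ball x₁ R)) *
                max 1 ((volume.restrict (ball x₁ R)) univ) :=
              eLpNorm_le_eLpNorm_mul_max_one_measure (by norm_num) h2q hmeas
          _ ≤ G t * W := by
              rw [hWx]
              exact mul_le_mul' (eLpNorm_mono_measure _ hμ) le_rfl
      calc eLpNorm (fun x => Real.sqrt (frobeniusNormSq (fderiv ℝ (u t) x))) 2
            (volume.restrict (ball x₁ R)) ^ (2 : ℝ)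
          ≤ (G t * W) ^ (2 : ℝ) := ENNReal.rpow_le_rpow h1 (by norm_num)
        _ = W ^ (2 : ℝ) * G t ^ (2 : ℝ) := by
            rw [ENNReal.mul_rpow_of_nonneg _ _ (by norm_num), mul_comm]
    have hGr : ∫⁻ t in Ioo (0 : ℝ) (R ^ 2), G t ^ r ≤ ENNReal.ofReal (D ^ r) :=
      (lintegral_mono_set (Ioo_subset_Ioo (by linarith) hTR)).trans hgrad
    have hvol : volume (Ioo (0 : ℝ) (R ^ 2)) ≤ ENNReal.ofReal (R ^ 2) := by
      rw [Real.volume_Ioo, sub_zero]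
    have hG2 : ∫⁻ t in Ioo (0 : ℝ) (R ^ 2), G t ^ (2 : ℝ) ≤ ENNReal.ofReal ((1 + R ^ 2) / C) :=
      lintegral_sq_le_of_lintegral_rpow_le hC1 hr2 hD hDC hR2.le hvol hGr
    have hW2 : W ^ (2 : ℝ) = ENNReal.ofReal (Wr ^ 2) := by
      rw [hWofReal, ENNReal.ofReal_rpow_of_nonneg hWr0.le (by norm_num), Real.rpow_two]
    calc ∫⁻ t in Ioo (0 : ℝ) (R ^ 2),
          eLpNorm (fun x => Real.sqrt (frobeniusNormSq (fderiv ℝ (u t) x))) 2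
            (volume.restrict (ball x₁ R)) ^ (2 : ℝ)
        ≤ ∫⁻ t in Ioo (0 : ℝ) (R ^ 2), W ^ (2 : ℝ) * G t ^ (2 : ℝ) :=
          setLIntegral_mono' measurableSet_Ioo fun t ht => hG8 t ht
      _ = W ^ (2 : ℝ) * ∫⁻ t in Ioo (0 : ℝ) (R ^ 2), G t ^ (2 : ℝ) :=
          lintegral_const_mul' _ _ (by rw [hW2]; exact ENNReal.ofReal_ne_top)
      _ ≤ W ^ (2 : ℝ) * ENNReal.ofReal ((1 + R ^ 2) / C) := mul_le_mul' le_rfl hG2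
      _ = ENNReal.ofReal (Wr ^ 2 * ((1 + R ^ 2) / C)) := by
          rw [hW2, ← ENNReal.ofReal_mul (by positivity)]
      _ ≤ ENNReal.ofReal (ε₀ ^ 2) := ENNReal.ofReal_le_ofReal hWC2

end Literature.Analysis.FluidPDE

end
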